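import Mathlib

/-!
# Sketch for crux SignConeDuality (stmt-RiemannHypothesis-16304), ideator k = 1, round 1

Idea `ratio-induction-multipliers`: a TOPOLOGY-FREE engine for the duality step.
One sign constraint at a time: the multiplier is an `sInf` of ratios; `N` constraints by
induction on `N`, peeling the last coordinate. No Hahn–Banach, no closure, no convexity
hypothesis beyond closure under `+` and positive scaling.

Everything in section `Engine` is PROVED (no sorry). Section `Instantiation` records the next
checkable statements of the line as signatures (sorried on purpose: NO skeleton at this stage).
-/

open scoped BigOperators
open Finset

namespace Summit.RiemannHypothesis.RiemannHypothesis.Cruxes.SignConeDuality.RatioInduction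

section Engine

/-- **One-constraint ratio lemma.** `S ⊆ ℝ × ℝ` closed under addition and positive scaling,
`0 ≤ x.2 → 0 ≤ x.1` on `S`, and a Slater point `x.2 > 0` in `S`. Then some `l ≥ 0` has
`l * x.2 ≤ x.1` on `S`. Proof: `l := sInf {x.1 / x.2 | x ∈ S, 0 < x.2}`; the only geometric input
is that for `x.2 < 0 < y.2` the positive combination `y.2 • x + (-x.2) • y ∈ S` has second
coordinate `0`, whence `x.1 / x.2 ≤ y.1 / y.2`. -/
theorem one_multiplier (S : Set (ℝ × ℝ))
    (hadd : ∀ x ∈ S, ∀ y ∈ S, x + y ∈ S)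
    (hsmul : ∀ r : ℝ, 0 < r → ∀ x ∈ S, r • x ∈ S)
    (hpos : ∀ x ∈ S, 0 ≤ x.2 → 0 ≤ x.1)
    (hslater : ∃ x ∈ S, 0 < x.2) :
    ∃ l : ℝ, 0 ≤ l ∧ ∀ x ∈ S, l * x.2 ≤ x.1 := by
  classical
  set A : Set ℝ := {r | ∃ x ∈ S, 0 < x.2 ∧ r = x.1 / x.2} with hA
  have hAne : A.Nonempty := by
    obtain ⟨x, hx, hx2⟩ := hslater
    exact ⟨x.1 / x.2, x, hx, hx2, rfl⟩
  have hA0 : ∀ r ∈ A, 0 ≤ r := by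
    rintro r ⟨x, hx, hx2, rfl⟩
    exact div_nonneg (hpos x hx hx2.le) hx2.le
  have hAbdd : BddBelow A := ⟨0, hA0⟩
  -- ratios at points with negative second coordinate lie below all of `A`
  have hkey : ∀ x ∈ S, x.2 < 0 → ∀ r ∈ A, x.1 / x.2 ≤ r := by
    rintro x hx hx2 r ⟨y, hy, hy2, rfl⟩
    have hz : y.2 • x + (-x.2) • y ∈ S :=
      hadd _ (hsmul _ hy2 x hx) _ (hsmul _ (by linarith) y hy)
    have hz2 : (0 : ℝ) ≤ (y.2 • x + (-x.2) • y).2 := by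
      simp only [Prod.snd_add, Prod.smul_snd, smul_eq_mul]
      nlinarith
    have hz1 : 0 ≤ (y.2 • x + (-x.2) • y).1 := hpos _ hz hz2
    simp only [Prod.fst_add, Prod.smul_fst, smul_eq_mul] at hz1
    rw [div_le_iff_of_neg hx2, div_mul_eq_mul_div, div_le_iff₀ hy2]
    nlinarith
  refine ⟨sInf A, le_csInf hAne hA0, fun x hx => ?_⟩
  rcases lt_trichotomy x.2 0 with h | h | h
  · have h1 : x.1 / x.2 ≤ sInf A := le_csInf hAne (hkey x hx h)
    rwa [div_le_iff_of_neg h] at h1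
  · rw [h, mul_zero]
    exact hpos x hx h.ge
  · have h1 : sInf A ≤ x.1 / x.2 := csInf_le hAbdd ⟨x, hx, h, rfl⟩
    rwa [le_div_iff₀ h] at h1

/-- **Cone multipliers by ratio induction** (finitely many sign constraints, indexed by `Fin N`).
`S ⊆ ℝ × ℝ^N` closed under `+` and positive scaling; if `x.2 ≥ 0 ⇒ x.1 ≥ 0` on `S` and `S` has a
Slater point (all `x.2 i > 0`), then `∃ l ≥ 0` with `∑ i, l i * x.2 i ≤ x.1` on `S`.
Induction on `N`: peel the last constraint with `one_multiplier` on the cone of points whose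
first `N` constraint coordinates are nonnegative, then recurse on the reduced cone with first
coordinate `x.1 - l_N * x.2 (last)`. -/
theorem cone_multipliers_fin : ∀ (N : ℕ) (S : Set (ℝ × (Fin N → ℝ))),
    (∀ x ∈ S, ∀ y ∈ S, x + y ∈ S) →
    (∀ r : ℝ, 0 < r → ∀ x ∈ S, r • x ∈ S) →
    (∀ x ∈ S, (∀ i, 0 ≤ x.2 i) → 0 ≤ x.1) →
    (∃ x ∈ S, ∀ i, 0 < x.2 i) →
    ∃ l : Fin N → ℝ, (∀ i, 0 ≤ l i) ∧ ∀ x ∈ S, ∑ i, l i * x.2 i ≤ x.1 := by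
  intro N
  induction N with
  | zero =>
    intro S _ _ hpos _
    exact ⟨fun _ => 0, fun i => i.elim0, fun x hx => by simpa using hpos x hx fun i => i.elim0⟩
  | succ N ih =>
    intro S hadd hsmul hpos hsl
    -- Step 1: the last constraint, on the cone where the first `N` constraints hold.
    let T : Set (ℝ × ℝ) :=
      {p | ∃ x ∈ S, (∀ i : Fin N, 0 ≤ x.2 (Fin.castSucc i)) ∧ p = (x.1, x.2 (Fin.last N))}
    have hTadd : ∀ p ∈ T, ∀ q ∈ T, p + q ∈ T := by
      rintro p ⟨x, hx, hxn, rfl⟩ q ⟨y, hy, hyn, rfl⟩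
      refine ⟨x + y, hadd x hx y hy, fun i => ?_, ?_⟩
      · simp only [Prod.snd_add, Pi.add_apply]
        exact add_nonneg (hxn i) (hyn i)
      · simp
    have hTsmul : ∀ r : ℝ, 0 < r → ∀ p ∈ T, r • p ∈ T := by
      rintro r hr p ⟨x, hx, hxn, rfl⟩
      refine ⟨r • x, hsmul r hr x hx, fun i => ?_, ?_⟩
      · simp only [Prod.smul_snd, Pi.smul_apply, smul_eq_mul]
        exact mul_nonneg hr.le (hxn i)
      · simp
    have hTpos : ∀ p ∈ T, 0 ≤ p.2 → 0 ≤ p.1 := by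
      rintro p ⟨x, hx, hxn, rfl⟩ hp
      refine hpos x hx fun i => ?_
      refine Fin.lastCases ?_ (fun j => ?_) i
      · simpa using hp
      · exact hxn j
    have hTsl : ∃ p ∈ T, 0 < p.2 := by
      obtain ⟨x, hx, hxp⟩ := hsl
      exact ⟨(x.1, x.2 (Fin.last N)), ⟨x, hx, fun i => (hxp _).le, rfl⟩, hxp _⟩
    obtain ⟨lN, hlN0, hlN⟩ := one_multiplier T hTadd hTsmul hTpos hTsl
    -- Step 2: the reduced cone in `ℝ × ℝ^N`.
    let S' : Set (ℝ × (Fin N → ℝ)) :=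
      {q | ∃ x ∈ S, q = (x.1 - lN * x.2 (Fin.last N), fun i => x.2 (Fin.castSucc i))}
    have hS'add : ∀ p ∈ S', ∀ q ∈ S', p + q ∈ S' := by
      rintro p ⟨x, hx, rfl⟩ q ⟨y, hy, rfl⟩
      refine ⟨x + y, hadd x hx y hy, ?_⟩
      ext <;> simp <;> ring
    have hS'smul : ∀ r : ℝ, 0 < r → ∀ p ∈ S', r • p ∈ S' := by
      rintro r hr p ⟨x, hx, rfl⟩
      refine ⟨r • x, hsmul r hr x hx, ?_⟩
      ext <;> simp <;> ring
    have hS'pos : ∀ q ∈ S', (∀ i, 0 ≤ q.2 i) → 0 ≤ q.1 := by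
      rintro q ⟨x, hx, rfl⟩ hq
      have := hlN (x.1, x.2 (Fin.last N)) ⟨x, hx, hq, rfl⟩
      simp only at this ⊢
      linarith
    have hS'sl : ∃ q ∈ S', ∀ i, 0 < q.2 i := by
      obtain ⟨x, hx, hxp⟩ := hsl
      exact ⟨_, ⟨x, hx, rfl⟩, fun i => hxp _⟩
    obtain ⟨l', hl'0, hl'⟩ := ih S' hS'add hS'smul hS'pos hS'sl
    refine ⟨Fin.snoc l' lN, fun i => ?_, fun x hx => ?_⟩
    · refine Fin.lastCases ?_ (fun j => ?_) i
      · simpa using hlN0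
      · simpa using hl'0 j
    · have := hl' _ ⟨x, hx, rfl⟩
      simp only at this
      rw [Fin.sum_univ_castSucc]
      simp only [Fin.snoc_castSucc, Fin.snoc_last]
      linarith

/-- The same engine for an arbitrary finite index type (e.g. the node set
`{n : ℕ // 2 ≤ n ∧ Real.log n < 2a}` or `Fin N` with node `i ↦ i + 2`). -/
theorem cone_multipliers {ι : Type*} [Fintype ι] (S : Set (ℝ × (ι → ℝ)))
    (hadd : ∀ x ∈ S, ∀ y ∈ S, x + y ∈ S)
    (hsmul : ∀ r : ℝ, 0 < r → ∀ x ∈ S, r • x ∈ S)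
    (hpos : ∀ x ∈ S, (∀ i, 0 ≤ x.2 i) → 0 ≤ x.1)
    (hslater : ∃ x ∈ S, ∀ i, 0 < x.2 i) :
    ∃ l : ι → ℝ, (∀ i, 0 ≤ l i) ∧ ∀ x ∈ S, ∑ i, l i * x.2 i ≤ x.1 := by
  classical
  let e := Fintype.equivFin ι
  let S' : Set (ℝ × (Fin (Fintype.card ι) → ℝ)) := {q | ∃ x ∈ S, q = (x.1, fun j => x.2 (e.symm j))}
  have hadd' : ∀ p ∈ S', ∀ q ∈ S', p + q ∈ S' := by
    rintro p ⟨x, hx, rfl⟩ q ⟨y, hy, rfl⟩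
    exact ⟨x + y, hadd x hx y hy, by ext <;> simp⟩
  have hsmul' : ∀ r : ℝ, 0 < r → ∀ p ∈ S', r • p ∈ S' := by
    rintro r hr p ⟨x, hx, rfl⟩
    exact ⟨r • x, hsmul r hr x hx, by ext <;> simp⟩
  have hpos' : ∀ q ∈ S', (∀ j, 0 ≤ q.2 j) → 0 ≤ q.1 := by
    rintro q ⟨x, hx, rfl⟩ hq
    exact hpos x hx fun i => by simpa using hq (e i)
  have hsl' : ∃ q ∈ S', ∀ j, 0 < q.2 j := by
    obtain ⟨x, hx, hxp⟩ := hslater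
    exact ⟨_, ⟨x, hx, rfl⟩, fun j => hxp _⟩
  obtain ⟨l', hl'0, hl'⟩ := cone_multipliers_fin _ S' hadd' hsmul' hpos' hsl'
  refine ⟨fun i => l' (e i), fun i => hl'0 _, fun x hx => ?_⟩
  have h := hl' _ ⟨x, hx, rfl⟩
  simp only at h
  calc ∑ i, l' (e i) * x.2 i = ∑ j, l' j * x.2 (e.symm j) := by
        rw [← e.sum_comp]
        simp
    _ ≤ x.1 := h

end Engine

section Instantiation

open MeasureTheory Set

/-! Next checkable statements of the line. All constants are Mathlib; the binders copy the item
text of `SignCone.SignConeDuality` (rev 3). `slater_bump` and `autocorr_eq_zero_of_two_mul_le`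
are PROVED here (cheap de-risking of the two instantiation facts the engine consumes);
`archPolar_add` is a signature only (in tree modulo `show`: `weilMellin_add`,
`weilArchIntegral_add`, `integrable_weilArchIntegrand`). -/

/-- A continuous function whose topological support lies in `[-a, a]` vanishes off `(-a, a)`. -/
theorem mem_Ioo_of_apply_ne_zero {a : ℝ} {g : ℝ → ℂ} (hg : Continuous g)
    (hsupp : tsupport g ⊆ Icc (-a) a) {s : ℝ} (hs : g s ≠ 0) : s ∈ Ioo (-a) a := by
  have h1 : Function.support g ⊆ interior (Icc (-a) a) :=
    interior_maximal ((subset_tsupport g).trans hsupp) hg.isOpen_support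
  rw [interior_Icc] at h1
  exact h1 (Function.mem_support.2 hs)

/-- Far nodes are invisible at cutoff `a`: an autocorrelation `g ⋆ g̃` of a test supported in
`[-a, a]` vanishes at every `t ≥ 2a` — INCLUDING the boundary `t = 2a` (the integrand is
identically zero, because `g` itself vanishes at `±a` by continuity). This is what lets the engine
index constraints by the STRICT node set `{n ≥ 2 : log n < 2a}` while the hypothesis `X_a` asks
node-nonnegativity at every `n ≥ 2`. -/
theorem autocorr_eq_zero_of_two_mul_le (a : ℝ) (g : ℝ → ℂ)
    (hg : ContDiff ℝ ((⊤ : ℕ∞) : WithTop ℕ∞) g ∧ HasCompactSupport g)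
    (hsupp : tsupport g ⊆ Set.Icc (-a) a) (t : ℝ) (ht : 2 * a ≤ t) :
    (MeasureTheory.convolution g (fun u => (starRingEnd ℂ) (g (-u)))
      (ContinuousLinearMap.mul ℂ ℂ) MeasureTheory.MeasureSpace.volume) t = 0 := by
  have hzero : (fun s => (ContinuousLinearMap.mul ℂ ℂ) (g s)
      ((fun u => (starRingEnd ℂ) (g (-u))) (t - s))) = fun _ => 0 := by
    funext s
    simp only [ContinuousLinearMap.mul_apply', neg_sub]
    by_cases hs : g s = 0
    · simp [hs]
    · have hs' := mem_Ioo_of_apply_ne_zero hg.1.continuous hsupp hs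
      have hst : g (s - t) = 0 := by
        by_contra h
        have h' := mem_Ioo_of_apply_ne_zero hg.1.continuous hsupp h
        linarith [hs'.2, h'.1]
      simp [hst]
  rw [convolution_def, hzero, integral_zero]

/-- Autocorrelation of a REAL function cast to `ℂ`, as a real integral. -/
theorem autocorr_ofReal_apply (ψ : ℝ → ℝ) (t : ℝ) :
    (MeasureTheory.convolution (fun x => ((ψ x : ℝ) : ℂ)) (fun u => (starRingEnd ℂ) (((ψ (-u) : ℝ) : ℂ)))
      (ContinuousLinearMap.mul ℂ ℂ) MeasureTheory.MeasureSpace.volume) t =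
      ((∫ s, ψ s * ψ (s - t) : ℝ) : ℂ) := by
  rw [convolution_def, ← integral_complex_ofReal]
  congr 1
  funext s
  simp [neg_sub, Complex.ofReal_mul]

/-- The Slater bump at cutoff `a`: radii `a/2 < a`, centre `0`. -/
noncomputable def slaterBump (a : ℝ) (ha : 0 < a) : ContDiffBump (0 : ℝ) :=
  ⟨a / 2, a, by positivity, by linarith⟩

/-- Slater point: ONE nonnegative smooth bump `g` supported in `[-a, a]` and positive on
`(-a, a)` has autocorrelation `g ⋆ g̃` with positive real part at every node `log n < 2a`
(indeed at every `|t| < 2a`). PROVED. -/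
theorem slater_bump (a : ℝ) (ha : 0 < a) :
    ∃ g : ℝ → ℂ, (ContDiff ℝ ((⊤ : ℕ∞) : WithTop ℕ∞) g ∧ HasCompactSupport g) ∧
      tsupport g ⊆ Set.Icc (-a) a ∧
      ∀ n : ℕ, 2 ≤ n → Real.log n < 2 * a →
        0 < ((MeasureTheory.convolution g (fun u => (starRingEnd ℂ) (g (-u)))
          (ContinuousLinearMap.mul ℂ ℂ) MeasureTheory.MeasureSpace.volume) (Real.log n)).re := by
  set φ := slaterBump a ha with hφ
  have hrOut : φ.rOut = a := rfl
  refine ⟨fun x => ((φ x : ℝ) : ℂ), ⟨?_, ?_⟩, ?_, fun n hn hlog => ?_⟩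
  · exact Complex.ofRealCLM.contDiff.comp φ.contDiff
  · exact φ.hasCompactSupport.comp_left (g := fun r : ℝ => (r : ℂ)) Complex.ofReal_zero
  · have hs : Function.support (fun x => ((φ x : ℝ) : ℂ)) = Function.support (φ : ℝ → ℝ) := by
      ext x; simp
    have ht : tsupport (fun x => ((φ x : ℝ) : ℂ)) = tsupport (φ : ℝ → ℝ) := by
      simp only [tsupport, hs]
    rw [ht, φ.tsupport_eq, hrOut, Real.closedBall_eq_Icc, zero_sub, zero_add]
  · set L := Real.log n with hL
    have hn1 : (1 : ℝ) < n := by exact_mod_cast (lt_of_lt_of_le one_lt_two hn)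
    have hLpos : 0 < L := Real.log_pos hn1
    have hconv := autocorr_ofReal_apply (φ : ℝ → ℝ) L
    simp only [] at hconv ⊢
    rw [hconv, Complex.ofReal_re]
    refine Continuous.integral_pos_of_hasCompactSupport_nonneg_nonzero (x := L / 2) ?_ ?_ ?_ ?_
    · exact φ.continuous.mul (φ.continuous.comp (continuous_id.sub continuous_const))
    · exact φ.hasCompactSupport.mul_right
    · exact fun s => mul_nonneg φ.nonneg φ.nonneg
    · have h1 : 0 < φ (L / 2) := by
        refine φ.pos_of_mem_ball ?_
        rw [Metric.mem_ball, dist_zero_right, Real.norm_eq_abs, hrOut, abs_of_pos (by linarith)]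
        linarith
      have h2 : 0 < φ (L / 2 - L) := by
        refine φ.pos_of_mem_ball ?_
        rw [Metric.mem_ball, dist_zero_right, Real.norm_eq_abs, hrOut,
          show L / 2 - L = -(L / 2) by ring, abs_neg, abs_of_pos (by linarith)]
        linarith
      exact (mul_pos h1 h2).ne'

/-- Moment additivity (the only analytic input of the engine's `hadd`): the prime-free Weil form
`F ↦ M_F 0 + M_F 1 + (1/2π) ∫ M_F(1/2+it) Re ψ(1/4+it/2) dt - F 0 log π` is additive on smooth
compactly supported kernels (in tree: `weilMellin_add`, `weilArchIntegral_add`,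
`integrable_weilArchIntegrand`, after `show`-ing the Literature vocabulary — or, cone-hygienic,
re-derived from `Real.fourierIntegral_iteratedDeriv` + `exists_norm_digamma_vertical_le`).
Signature only. -/
theorem archPolar_add (F₁ F₂ : ℝ → ℂ)
    (h₁ : ContDiff ℝ ((⊤ : ℕ∞) : WithTop ℕ∞) F₁ ∧ HasCompactSupport F₁)
    (h₂ : ContDiff ℝ ((⊤ : ℕ∞) : WithTop ℕ∞) F₂ ∧ HasCompactSupport F₂) :
    let W : (ℝ → ℂ) → ℂ := fun F =>
      let M : ℂ → ℂ := fun s => ∫ u : ℝ, F u * Complex.exp ((s - 1 / 2) * u)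
      M 0 + M 1 + ((1 / (2 * Real.pi) : ℂ) * (∫ t : ℝ, M (1 / 2 + t * Complex.I) *
        ((Complex.digamma (1 / 4 + t / 2 * Complex.I)).re : ℂ)) - F 0 * (Real.log Real.pi : ℂ))
    W (F₁ + F₂) = W F₁ + W F₂ := by
  sorry

end Instantiation

end Summit.RiemannHypothesis.RiemannHypothesis.Cruxes.SignConeDuality.RatioInduction
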